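import Literature.Probability.RandomPlanarGeometry.LSW2004KeyEstimateComputation
import HarnessLib

/-!
# [LSW04] §3.2 transposed to the planar self-avoiding walk: the touching observable and `κ = 8/3`

G. F. Lawler, O. Schramm, W. Werner, *Conformal invariance of planar loop-erased random walks and
uniform spanning trees*, Ann. Probab. **32** (2004) 939–995 (**[LSW04]**), §3.2–3.3 (the LERW
driving-function argument, Prop. 3.4 "the key estimate") and its UST twin Prop. 4.3 give the
general recipe by which a discrete *martingale observable* identifies the driving function of an
exploration process: on each mesoscopic step one has a random variable `q` (a ratio of conditional
probabilities) with conditional mean **exactly `1`**, which is within `O(δ³)` of an explicit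
functional `F(x; U, D, W)` of the one-step Loewner data — `W` the driving increment, `t` the
capacity increment, `U = g_t(x)`, `D = g_t'(x)` for a marked boundary point `x`, with the Loewner
far-field expansions `U = x + 2t/x + O(δ³)`, `D = 1 - 2t/x² + O(δ³)` (LSW04 (4.11)). One
Taylor-expands `F` to second order in `W` and first order in `t`, integrates, and reads off two
linear relations between `E[W]`, `E[W²]`, `E[t]` from two marked points; solving the `2 × 2` system
gives `E[W] = O(δ³)` and `E[W²] = κ E[t] + O(δ³)`.

This file is that deterministic computation for the **boundary-touching observable of the planar
self-avoiding walk**, whose conjectured scaling limit is `SLE_{8/3}`: for a far boundary bump at the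
(current) boundary point `x`, the `SLE_{8/3}` value of "the curve touches the bump", renormalised,
is the restriction boundary martingale `g_t'(x)² / (g_t(x) - W_t)²` (boundary exponent `2`,
restriction exponent `5/8`; Lawler–Schramm–Werner, *Conformal restriction: the chordal case*,
JAMS **16** (2003), §8 [LawlerSchrammWerner2003Restriction]). Normalising by the time-`0` value
`1/x²` gives the functional

* `touchF x U D W = x² D² / (U - W)²`,

and the content of the file is:

* `touchF_taylor` — with `U = x + 2t/x + O(δ³)`, `D = 1 - 2t/x² + O(δ³)`, `|W| ≤ 2δ`, `0 ≤ t ≤ 2δ²`,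
  `1 ≤ |x| ≤ 2`: **`touchF = 1 + 2W/x + (3W² - 8t)/x² + O(δ³)`** (elementary algebra of a
  rational function: with `p = W/x`, `s = t/x²` one has `touchF = (1 - 2s + ε₂)²/(1 - p + 2s + ε₁)²`
  with `εᵢ = O(δ³)`, and `(1 - 2s + ε₂) - (1 + p + p² - 4s)(1 - p + 2s + ε₁)`,
  `(1 + p + p² - 4s)² - (1 + 2p + 3p² - 8s)` are explicit cubic remainders);
* `touch_key_relations` — "combining the two relations": if `|2B/x₁ + M/x₁²| ≤ ε` and
  `|2B/x₂ + M/x₂²| ≤ ε` with `x₁ ∈ [1, 2]`, `x₂ ∈ [-2, -1]`, then `|B| ≤ 2ε`, `|M| ≤ 12ε`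
  (`B = E[W]`, `M = 3E[W²] - 8E[t]`);
* `touchKey_of_estimates` — **the key estimate from the printed intermediate estimates**, on any
  probability space (it is applied atom by atom, with `P` the conditional law on an atom of the
  past): given `W, t` with `|W| ≤ 2δ`, `0 ≤ t ≤ 2δ²`, Loewner data `Uᵢ, Dᵢ` at two bumps
  `x₁ ∈ [1, 2]`, `x₂ ∈ [-2, -1]` obeying the far-field expansions up to `Kδ³`, and observables `qᵢ`
  with `E[qᵢ] = 1`, `|qᵢ - touchF xᵢ Uᵢ Dᵢ W| ≤ Kδ³`, then
  **`|E[W]| ≤ Cδ³` and `|E[W²] - (8/3) E[t]| ≤ Cδ³`**, i.e. `κ = 8/3`.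

Check by hand: `(1+b)²/(1+a)²`, `a = 2s - p + ε₁`, `b = -2s + ε₂`, is `1 + 2b - 2a + 3a² + O(δ³)
= 1 + 2p + 3p² - 8s + O(δ³)`; at `x = ±1` the relations `±2E[W] + 3E[W²] - 8E[t] = O(δ³)` give
`E[W] = O(δ³)`, `E[W²] = (8/3)E[t] + O(δ³)`. NOT here: anything about the self-avoiding walk itself
(the observable's convergence — conformal invariance — is the open input producing the `qᵢ`); the
integration bookkeeping reuses `USTPeano.KeyEstimate.abs_integral_le_of_pointwise` (UST twin file).

## References

* [LSW04] §3.2–3.3 (Prop. 3.4) and §4.2 (Prop. 4.3, (4.9)–(4.12)) [LawlerSchrammWerner2004].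
* Lawler–Schramm–Werner 2003, *Conformal restriction: the chordal case*, §8 (restriction
  measures and `SLE_{8/3}`; the boundary martingale `g'(x)^2/(g(x) - W)^2`)
  [LawlerSchrammWerner2003Restriction].
-/

noncomputable section

open MeasureTheory

namespace Literature.Probability.RandomPlanarGeometry.SAWDriving

/-- **The SAW touching functional.** The `SLE_{8/3}` (restriction, boundary exponent `2`) value,
after one Loewner step with data `U = g(x)`, `D = g'(x)`, driving position `W`, of the event that
the curve touches a far boundary bump at `x`, normalised by its initial value `x⁻²`:
`touchF x U D W = x² D² / (U - W)²`. [cite: LawlerSchrammWerner2003Restriction, §8] -/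
def touchF (x U D W : ℝ) : ℝ := x ^ 2 * D ^ 2 / (U - W) ^ 2

/-- Products of bounded quantities: `|a| ≤ A`, `|b| ≤ B` give `|ab| ≤ AB`. [folklore] -/
private theorem abs_mul_le_mul_of_abs_le {a b A B : ℝ} (ha : |a| ≤ A) (hb : |b| ≤ B) :
    |a * b| ≤ A * B := by
  rw [abs_mul]
  exact mul_le_mul ha hb (abs_nonneg _) ((abs_nonneg _).trans ha)

/-- **The reduced computation.** In the variables `p = W/x`, `s = t/x²`, `ε₁ = (U - x - 2t/x)/x`,
`ε₂ = D - (1 - 2t/x²)` the touching functional is `(1 - 2s + ε₂)² / (1 - p + 2s + ε₁)²`, and for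
`|p| ≤ 2δ`, `0 ≤ s ≤ 2δ²`, `|εᵢ| ≤ Kδ³`, `δ ≤ δ₀(K)`:
`|(1 - 2s + ε₂)²/(1 - p + 2s + ε₁)² - (1 + 2p + 3p² - 8s)| ≤ C δ³`. The proof writes
`r = (1 - 2s + ε₂)/(1 - p + 2s + ε₁)`, `L = 1 + p + p² - 4s`, so that `r - L = R₁/(1 - p + 2s + ε₁)`
and `L² - (1 + 2p + 3p² - 8s) = R₂` with explicit cubic polynomials `R₁, R₂`, and
`r² - T = (r - L)(r + L) + R₂`. [cite: LawlerSchrammWerner2004, §3.2] -/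
theorem ratio_sq_taylor (K : ℝ) (hK : 0 ≤ K) : ∃ δ₀ : ℝ, 0 < δ₀ ∧ ∃ C : ℝ, ∀ δ : ℝ, 0 < δ → δ ≤ δ₀ →
    ∀ p s ε₁ ε₂ : ℝ, |p| ≤ 2 * δ → 0 ≤ s → s ≤ 2 * δ ^ 2 → |ε₁| ≤ K * δ ^ 3 → |ε₂| ≤ K * δ ^ 3 →
      |(1 - 2 * s + ε₂) ^ 2 / (1 - p + 2 * s + ε₁) ^ 2 - (1 + 2 * p + 3 * p ^ 2 - 8 * s)| ≤
        C * δ ^ 3 := by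
  refine ⟨min (1 / 8) (1 / (K + 1)), lt_min (by norm_num) (by positivity),
    10 * (8 * K + 72) + 152, ?_⟩
  intro δ hδ hδ₀ p s ε₁ ε₂ hp hs0 hs hε₁ hε₂
  have hδ8 : δ ≤ 1 / 8 := hδ₀.trans (min_le_left _ _)
  have hδK : δ ≤ 1 / (K + 1) := hδ₀.trans (min_le_right _ _)
  have hδ0 : 0 ≤ δ := hδ.le
  have hδ1 : δ ≤ 1 := by linarith
  have hδsq : δ ^ 2 ≤ 1 / 64 := (pow_le_pow_left₀ hδ0 hδ8 2).trans (by norm_num)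
  have hKδ : K * δ ≤ 1 := by
    calc K * δ ≤ K * (1 / (K + 1)) := mul_le_mul_of_nonneg_left hδK hK
      _ ≤ 1 := by rw [mul_one_div, div_le_one (by linarith)]; linarith
  have hKδ3 : K * δ ^ 3 ≤ 1 / 64 := by
    calc K * δ ^ 3 = K * δ * δ ^ 2 := by ring
      _ ≤ 1 * δ ^ 2 := mul_le_mul_of_nonneg_right hKδ (by positivity)
      _ ≤ 1 / 64 := by linarith
  -- sizes of the reduced variables
  have hp4 : |p| ≤ 1 / 4 := by linarith
  have hp1 : |p| ≤ 1 := by linarith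
  have hs' : |s| ≤ 2 * δ ^ 2 := by rwa [abs_of_nonneg hs0]
  have hs'' : |s| ≤ 2 * δ := by
    rw [abs_of_nonneg hs0]
    linarith [sq_le hδ0 hδ1]
  have hs1 : |s| ≤ 1 := by rw [abs_of_nonneg hs0]; linarith
  have hs32 : s ≤ 1 / 32 := by linarith
  have hpsq : p ^ 2 ≤ 1 / 16 := by
    rw [← sq_abs]
    exact (pow_le_pow_left₀ (abs_nonneg p) hp4 2).trans (by norm_num)
  -- the two explicit cubic remainders
  obtain ⟨R₁, hR₁⟩ : ∃ R : ℝ, R = ε₂ - ε₁ - 6 * (p * s) + p * (p * p) - p * ε₁ - 2 * (p * (p * s)) -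
      p * (p * ε₁) + 8 * (s * s) + 4 * (s * ε₁) := ⟨_, rfl⟩
  obtain ⟨R₂, hR₂⟩ : ∃ R : ℝ, R = 2 * (p * (p * p)) - 8 * (p * s) + p * (p * (p * p)) -
      8 * (p * (p * s)) + 16 * (s * s) := ⟨_, rfl⟩
  -- monomial bounds
  have m1 : |p * s| ≤ 2 * δ * (2 * δ ^ 2) := abs_mul_le_mul_of_abs_le hp hs'
  have m2 : |p * (p * p)| ≤ 2 * δ * (2 * δ * (2 * δ)) :=
    abs_mul_le_mul_of_abs_le hp (abs_mul_le_mul_of_abs_le hp hp)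
  have m3 : |p * ε₁| ≤ 1 * (K * δ ^ 3) := abs_mul_le_mul_of_abs_le hp1 hε₁
  have m4 : |p * (p * s)| ≤ 1 * (2 * δ * (2 * δ ^ 2)) := abs_mul_le_mul_of_abs_le hp1 m1
  have m5 : |p * (p * ε₁)| ≤ 1 * (1 * (K * δ ^ 3)) := abs_mul_le_mul_of_abs_le hp1 m3
  have m6 : |s * s| ≤ 2 * δ * (2 * δ ^ 2) := abs_mul_le_mul_of_abs_le hs'' hs'
  have m7 : |s * ε₁| ≤ 1 * (K * δ ^ 3) := abs_mul_le_mul_of_abs_le hs1 hε₁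
  have m8 : |p * (p * (p * p))| ≤ 1 * (2 * δ * (2 * δ * (2 * δ))) := abs_mul_le_mul_of_abs_le hp1 m2
  obtain ⟨a1, b1⟩ := abs_le.mp m1; obtain ⟨a2, b2⟩ := abs_le.mp m2; obtain ⟨a3, b3⟩ := abs_le.mp m3
  obtain ⟨a4, b4⟩ := abs_le.mp m4; obtain ⟨a5, b5⟩ := abs_le.mp m5; obtain ⟨a6, b6⟩ := abs_le.mp m6
  obtain ⟨a7, b7⟩ := abs_le.mp m7; obtain ⟨a8, b8⟩ := abs_le.mp m8
  obtain ⟨c1, d1⟩ := abs_le.mp hε₁; obtain ⟨c2, d2⟩ := abs_le.mp hε₂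
  have hR₁le : |R₁| ≤ (8 * K + 72) * δ ^ 3 := by
    rw [hR₁, abs_le]; constructor <;> linarith
  have hR₂le : |R₂| ≤ 152 * δ ^ 3 := by
    rw [hR₂, abs_le]; constructor <;> linarith
  -- the denominator is ≥ 1/2
  obtain ⟨hpl, hpu⟩ := abs_le.mp hp4
  have hA : 1 / 2 ≤ 1 - p + 2 * s + ε₁ := by linarith
  have hApos : 0 < 1 - p + 2 * s + ε₁ := by linarith
  have hA0 : 1 - p + 2 * s + ε₁ ≠ 0 := hApos.ne'
  -- the ratio `r` and the algebraic identities
  obtain ⟨r, hr⟩ : ∃ r : ℝ, r = (1 - 2 * s + ε₂) / (1 - p + 2 * s + ε₁) := ⟨_, rfl⟩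
  have hrL : r - (1 + p + p ^ 2 - 4 * s) = R₁ / (1 - p + 2 * s + ε₁) := by
    rw [hr, hR₁, eq_div_iff hA0, sub_mul, div_mul_cancel₀ _ hA0]
    ring
  have key : (1 - 2 * s + ε₂) ^ 2 / (1 - p + 2 * s + ε₁) ^ 2 - (1 + 2 * p + 3 * p ^ 2 - 8 * s) =
      (r - (1 + p + p ^ 2 - 4 * s)) * (r + (1 + p + p ^ 2 - 4 * s)) + R₂ := by
    rw [← div_pow, ← hr, hR₂]
    ring
  -- sizes of `r - L`, `r`, `L`
  have h1 : |r - (1 + p + p ^ 2 - 4 * s)| ≤ 2 * |R₁| := by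
    rw [hrL, abs_div, abs_of_pos hApos, div_le_iff₀ hApos]
    have := mul_le_mul_of_nonneg_left hA (by positivity : (0 : ℝ) ≤ 2 * |R₁|)
    linarith
  have hBn : |1 - 2 * s + ε₂| ≤ 3 / 2 := by
    rw [abs_le]; constructor <;> linarith
  have hrabs : |r| ≤ 3 := by
    rw [hr, abs_div, abs_of_pos hApos, div_le_iff₀ hApos]
    linarith
  have hLabs : |1 + p + p ^ 2 - 4 * s| ≤ 2 := by
    rw [abs_le]; constructor <;> linarith [sq_nonneg p]
  rw [key]
  calc |(r - (1 + p + p ^ 2 - 4 * s)) * (r + (1 + p + p ^ 2 - 4 * s)) + R₂|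
      ≤ |r - (1 + p + p ^ 2 - 4 * s)| * |r + (1 + p + p ^ 2 - 4 * s)| + |R₂| := by
        rw [← abs_mul]; exact abs_add_le _ _
    _ ≤ 2 * |R₁| * (3 + 2) + |R₂| :=
        add_le_add (mul_le_mul h1 ((abs_add_le _ _).trans (add_le_add hrabs hLabs))
          (abs_nonneg _) (by positivity)) le_rfl
    _ ≤ 2 * ((8 * K + 72) * δ ^ 3) * (3 + 2) + 152 * δ ^ 3 := by linarith
    _ = (10 * (8 * K + 72) + 152) * δ ^ 3 := by ring

/-- **The Taylor expansion of the touching functional** ([LSW04] §3.2 / proof of Prop. 4.3, "We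
Taylor-expand … to second order in `W` and to first order in" the Loewner displacements, transposed
to `F = x²D²/(U - W)²`): for every `K ≥ 0` there are `δ₀ > 0` and `C` such that for
`0 < δ ≤ δ₀`, `1 ≤ |x| ≤ 2`, `|W| ≤ 2δ`, `0 ≤ t ≤ 2δ²`, `|U - x - 2t/x| ≤ Kδ³`,
`|D - (1 - 2t/x²)| ≤ Kδ³`:
**`|touchF x U D W - 1 - (2W/x + (3W² - 8t)/x²)| ≤ C δ³`.** [cite: LawlerSchrammWerner2004, §3.2] -/
theorem touchF_taylor (K : ℝ) (hK : 0 ≤ K) : ∃ δ₀ : ℝ, 0 < δ₀ ∧ ∃ C : ℝ, ∀ δ : ℝ, 0 < δ → δ ≤ δ₀ →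
    ∀ x U D W t : ℝ, 1 ≤ |x| → |x| ≤ 2 → |W| ≤ 2 * δ → 0 ≤ t → t ≤ 2 * δ ^ 2 →
      |U - x - 2 * t / x| ≤ K * δ ^ 3 → |D - (1 - 2 * t / x ^ 2)| ≤ K * δ ^ 3 →
      |touchF x U D W - 1 - (2 * W / x + (3 * W ^ 2 - 8 * t) / x ^ 2)| ≤ C * δ ^ 3 := by
  obtain ⟨δ₀, hδ₀, C, hC⟩ := ratio_sq_taylor K hK
  refine ⟨δ₀, hδ₀, C, fun δ hδ hδ' x U D W t hx _ hW ht ht' hU hD ↦ ?_⟩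
  have hx0 : x ≠ 0 := fun h ↦ by rw [h, abs_zero] at hx; linarith
  have hy : |x⁻¹| ≤ 1 := by rw [abs_inv]; exact inv_le_one_of_one_le₀ hx
  have hy2 : x⁻¹ ^ 2 ≤ 1 := by
    have := pow_le_one₀ (n := 2) (abs_nonneg x⁻¹) hy
    rwa [sq_abs] at this
  -- the reduced variables and their sizes
  have hp : |W * x⁻¹| ≤ 2 * δ := by
    rw [abs_mul]
    calc |W| * |x⁻¹| ≤ 2 * δ * 1 := mul_le_mul hW hy (abs_nonneg _) ((abs_nonneg _).trans hW)
      _ = 2 * δ := mul_one _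
  have hs0 : 0 ≤ t * x⁻¹ ^ 2 := by positivity
  have hs : t * x⁻¹ ^ 2 ≤ 2 * δ ^ 2 := by
    calc t * x⁻¹ ^ 2 ≤ t * 1 := mul_le_mul_of_nonneg_left hy2 ht
      _ ≤ 2 * δ ^ 2 := by linarith
  have hε₁ : |(U - x - 2 * t / x) * x⁻¹| ≤ K * δ ^ 3 := by
    rw [abs_mul]
    calc |U - x - 2 * t / x| * |x⁻¹| ≤ K * δ ^ 3 * 1 :=
          mul_le_mul hU hy (abs_nonneg _) ((abs_nonneg _).trans hU)
      _ = K * δ ^ 3 := mul_one _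
  have h := hC δ hδ hδ' (W * x⁻¹) (t * x⁻¹ ^ 2) ((U - x - 2 * t / x) * x⁻¹)
    (D - (1 - 2 * t / x ^ 2)) hp hs0 hs hε₁ hD
  -- identification with `touchF`
  have hxx : x * x⁻¹ = 1 := mul_inv_cancel₀ hx0
  have e1 : 1 - 2 * (t * x⁻¹ ^ 2) + (D - (1 - 2 * t / x ^ 2)) = D := by ring
  have e2 : 1 - W * x⁻¹ + 2 * (t * x⁻¹ ^ 2) + (U - x - 2 * t / x) * x⁻¹ = (U - W) * x⁻¹ := by
    calc 1 - W * x⁻¹ + 2 * (t * x⁻¹ ^ 2) + (U - x - 2 * t / x) * x⁻¹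
        = (U - W) * x⁻¹ + (1 - x * x⁻¹) := by ring
      _ = (U - W) * x⁻¹ := by rw [hxx]; ring
  have e3 : 1 + 2 * (W * x⁻¹) + 3 * (W * x⁻¹) ^ 2 - 8 * (t * x⁻¹ ^ 2) =
      1 + (2 * W / x + (3 * W ^ 2 - 8 * t) / x ^ 2) := by ring
  have e4 : D ^ 2 / ((U - W) * x⁻¹) ^ 2 = touchF x U D W := by
    rw [touchF, ← mul_div_mul_left (D ^ 2) (((U - W) * x⁻¹) ^ 2) (pow_ne_zero 2 hx0)]
    congr 1
    calc x ^ 2 * ((U - W) * x⁻¹) ^ 2 = (U - W) ^ 2 * (x * x⁻¹) ^ 2 := by ring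
      _ = (U - W) ^ 2 := by rw [hxx]; ring
  rw [e1, e2, e3, e4] at h
  rwa [sub_sub]

/-- **"Combining these two relations"** ([LSW04], end of the proofs of Prop. 3.4 / Prop. 4.3), for
the touching observable read at two boundary bumps `x₁ ∈ [1, 2]` and `x₂ ∈ [-2, -1]`: if
`|2B/x₁ + M/x₁²| ≤ ε` and `|2B/x₂ + M/x₂²| ≤ ε` then `|B| ≤ 2ε` and `|M| ≤ 12ε`
(`B = E[W]`, `M = 3E[W²] - 8E[t]`; the `2 × 2` system has determinant `2(x₂ - x₁)/(x₁x₂)²`,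
bounded away from `0`). [folklore] -/
theorem touch_key_relations {x₁ x₂ B M ε : ℝ} (hx₁ : 1 ≤ x₁) (hx₁' : x₁ ≤ 2) (hx₂ : -2 ≤ x₂)
    (hx₂' : x₂ ≤ -1) (h₁ : |2 * B / x₁ + M / x₁ ^ 2| ≤ ε) (h₂ : |2 * B / x₂ + M / x₂ ^ 2| ≤ ε) :
    |B| ≤ 2 * ε ∧ |M| ≤ 12 * ε := by
  have hx₁0 : x₁ ≠ 0 := by positivity
  have hx₂0 : x₂ ≠ 0 := by
    intro h
    rw [h] at hx₂'
    linarith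
  have hε : 0 ≤ ε := (abs_nonneg _).trans h₁
  have e₁ : 2 * B * x₁ + M = x₁ ^ 2 * (2 * B / x₁ + M / x₁ ^ 2) := by
    field_simp
  have e₂ : 2 * B * x₂ + M = x₂ ^ 2 * (2 * B / x₂ + M / x₂ ^ 2) := by
    field_simp
  have hsq₁ : x₁ ^ 2 ≤ 4 := by nlinarith
  have hsq₂ : x₂ ^ 2 ≤ 4 := by nlinarith
  have s₁ : |2 * B * x₁ + M| ≤ 4 * ε := by
    rw [e₁, abs_mul, abs_pow, sq_abs]
    exact mul_le_mul hsq₁ h₁ (abs_nonneg _) (by norm_num)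
  have s₂ : |2 * B * x₂ + M| ≤ 4 * ε := by
    rw [e₂, abs_mul, abs_pow, sq_abs]
    exact mul_le_mul hsq₂ h₂ (abs_nonneg _) (by norm_num)
  have hd : 2 ≤ x₁ - x₂ := by linarith
  have hBkey : 2 * (x₁ - x₂) * |B| ≤ 8 * ε := by
    have h := abs_sub (2 * B * x₁ + M) (2 * B * x₂ + M)
    have e : 2 * B * x₁ + M - (2 * B * x₂ + M) = 2 * (x₁ - x₂) * B := by ring
    rw [e, abs_mul, abs_of_nonneg (by linarith : (0 : ℝ) ≤ 2 * (x₁ - x₂))] at h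
    linarith
  have hB : |B| ≤ 2 * ε := by
    have := mul_le_mul_of_nonneg_right (by linarith : (2 : ℝ) * 2 ≤ 2 * (x₁ - x₂)) (abs_nonneg B)
    linarith
  refine ⟨hB, ?_⟩
  have h := abs_sub (2 * B * x₁ + M) (2 * x₁ * B)
  have e : 2 * B * x₁ + M - 2 * x₁ * B = M := by ring
  rw [e, abs_mul, abs_of_nonneg (by linarith : (0 : ℝ) ≤ 2 * x₁)] at h
  have := mul_le_mul_of_nonneg_right (by linarith : 2 * x₁ ≤ (2 : ℝ) * 2) (abs_nonneg B)
  linarith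

/-- **The key estimate for the SAW touching observable, from the intermediate estimates** ([LSW04]
§3.2 recipe / Prop. 4.3 with (4.9)–(4.12) taken as hypotheses, for `F = x²D²/(U - W)²`). On a
probability space (in the application: the conditional law on an atom of the past) carrying the
driving increment `W` (`|W| ≤ 2δ`), the capacity increment `t` (`0 ≤ t ≤ 2δ²`), the Loewner data
`U₁, D₁` of a bump at `x₁ ∈ [1, 2]` and `U₂, D₂` of a bump at `x₂ ∈ [-2, -1]` obeying the far-field
expansions `|Uᵢ - xᵢ - 2t/xᵢ| ≤ Kδ³`, `|Dᵢ - (1 - 2t/xᵢ²)| ≤ Kδ³`, and the two normalised touching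
observables `q₁, q₂` with `E[qᵢ] = 1` (the martingale property) and
`|qᵢ - touchF xᵢ Uᵢ Dᵢ W| ≤ Kδ³` (observable `=` its `SLE_{8/3}` value up to `O(δ³)`): then
**`|E[W]| ≤ Cδ³` and `|E[W²] - (8/3) E[t]| ≤ Cδ³`** — the key estimate with `κ = 8/3` — by
integrating `touchF_taylor` at both bumps (`USTPeano.KeyEstimate.abs_integral_le_of_pointwise`)
and `touch_key_relations`. [cite: LawlerSchrammWerner2004, §3.2] -/
theorem touchKey_of_estimates (K : ℝ) (hK : 0 ≤ K) : ∃ δ₀ : ℝ, 0 < δ₀ ∧ ∃ C : ℝ, ∀ δ : ℝ,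
    0 < δ → δ ≤ δ₀ → ∀ {Ω : Type*} [MeasurableSpace Ω] (P : Measure Ω) [IsProbabilityMeasure P]
      (x₁ x₂ : ℝ) (W t U₁ D₁ U₂ D₂ q₁ q₂ : Ω → ℝ),
      1 ≤ x₁ → x₁ ≤ 2 → -2 ≤ x₂ → x₂ ≤ -1 →
      AEStronglyMeasurable W P → AEStronglyMeasurable t P →
      AEStronglyMeasurable q₁ P → AEStronglyMeasurable q₂ P →
      (∀ ω, |W ω| ≤ 2 * δ) → (∀ ω, 0 ≤ t ω ∧ t ω ≤ 2 * δ ^ 2) →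
      (∀ ω, |U₁ ω - x₁ - 2 * t ω / x₁| ≤ K * δ ^ 3) →
      (∀ ω, |D₁ ω - (1 - 2 * t ω / x₁ ^ 2)| ≤ K * δ ^ 3) →
      (∀ ω, |U₂ ω - x₂ - 2 * t ω / x₂| ≤ K * δ ^ 3) →
      (∀ ω, |D₂ ω - (1 - 2 * t ω / x₂ ^ 2)| ≤ K * δ ^ 3) →
      (∀ ω, |q₁ ω - touchF x₁ (U₁ ω) (D₁ ω) (W ω)| ≤ K * δ ^ 3) → ∫ ω, q₁ ω ∂P = 1 →
      (∀ ω, |q₂ ω - touchF x₂ (U₂ ω) (D₂ ω) (W ω)| ≤ K * δ ^ 3) → ∫ ω, q₂ ω ∂P = 1 →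
      |∫ ω, W ω ∂P| ≤ C * δ ^ 3 ∧ |∫ ω, W ω ^ 2 ∂P - 8 / 3 * ∫ ω, t ω ∂P| ≤ C * δ ^ 3 := by
  obtain ⟨δ₀, hδ₀, C, hC⟩ := touchF_taylor K hK
  refine ⟨δ₀, hδ₀, 4 * (C + K), ?_⟩
  intro δ hδ hδ' Ω _ P _ x₁ x₂ W t U₁ D₁ U₂ D₂ q₁ q₂ hx₁ hx₁' hx₂ hx₂' hWm htm hq₁m hq₂m hW ht hU₁
    hD₁ hU₂ hD₂ hq₁ hq₁int hq₂ hq₂int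
  have hax₁ : |x₁| = x₁ := abs_of_pos (by linarith)
  have hax₂ : |x₂| = -x₂ := abs_of_neg (by linarith)
  -- integrability of `W`, `W²`, `t`
  have hWi : Integrable W P := Integrable.of_bound hWm (2 * δ) (ae_of_all _ fun ω ↦ by
    rw [Real.norm_eq_abs]; exact hW ω)
  have hW2i : Integrable (fun ω ↦ W ω ^ 2) P := Integrable.of_bound (hWm.pow 2) ((2 * δ) ^ 2)
    (ae_of_all _ fun ω ↦ by
      rw [Real.norm_eq_abs, abs_pow]
      exact pow_le_pow_left₀ (abs_nonneg _) (hW ω) 2)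
  have hti : Integrable t P := Integrable.of_bound htm (2 * δ ^ 2) (ae_of_all _ fun ω ↦ by
    rw [Real.norm_eq_abs, abs_of_nonneg (ht ω).1]; exact (ht ω).2)
  -- the integrated relation at a general bump `x` with `1 ≤ |x| ≤ 2`
  have relation : ∀ (x : ℝ) (U D q : Ω → ℝ), 1 ≤ |x| → |x| ≤ 2 → AEStronglyMeasurable q P →
      (∀ ω, |U ω - x - 2 * t ω / x| ≤ K * δ ^ 3) →
      (∀ ω, |D ω - (1 - 2 * t ω / x ^ 2)| ≤ K * δ ^ 3) →
      (∀ ω, |q ω - touchF x (U ω) (D ω) (W ω)| ≤ K * δ ^ 3) → ∫ ω, q ω ∂P = 1 →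
      |2 * (∫ ω, W ω ∂P) / x + (3 * (∫ ω, W ω ^ 2 ∂P) - 8 * (∫ ω, t ω ∂P)) / x ^ 2| ≤
        (C + K) * δ ^ 3 := by
    intro x U D q hx hx' hqm hU hD hq hqint
    have e : ∀ ω, |touchF x (U ω) (D ω) (W ω) - 1 -
        (2 * W ω / x + (3 * W ω ^ 2 - 8 * t ω) / x ^ 2)| ≤ C * δ ^ 3 := fun ω ↦
      hC δ hδ hδ' x (U ω) (D ω) (W ω) (t ω) hx hx' (hW ω) (ht ω).1 (ht ω).2 (hU ω) (hD ω)
    have hx0 : 0 < |x| := by linarith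
    have hx1 : 1 ≤ |x| ^ 2 := one_le_pow₀ hx
    -- a uniform bound on the linear part
    have lin : ∀ ω, |2 * W ω / x + (3 * W ω ^ 2 - 8 * t ω) / x ^ 2| ≤ 4 * δ + 28 * δ ^ 2 := by
      intro ω
      have g1 : |2 * W ω / x| ≤ 2 * (2 * δ) := by
        rw [abs_div, abs_mul, abs_two, div_le_iff₀ hx0]
        calc 2 * |W ω| ≤ 2 * (2 * δ) := by linarith [hW ω]
          _ = 2 * (2 * δ) * 1 := (mul_one _).symm
          _ ≤ 2 * (2 * δ) * |x| := mul_le_mul_of_nonneg_left hx (by linarith)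
      have hW2 : W ω ^ 2 ≤ (2 * δ) ^ 2 := by
        have := pow_le_pow_left₀ (abs_nonneg _) (hW ω) 2
        rwa [sq_abs] at this
      have g3 : |3 * W ω ^ 2 - 8 * t ω| ≤ 3 * (2 * δ) ^ 2 + 8 * (2 * δ ^ 2) := by
        rw [abs_le]
        constructor <;> linarith [(ht ω).1, (ht ω).2, sq_nonneg (W ω)]
      have g2 : |(3 * W ω ^ 2 - 8 * t ω) / x ^ 2| ≤ 3 * (2 * δ) ^ 2 + 8 * (2 * δ ^ 2) := by
        rw [abs_div, abs_pow, div_le_iff₀ (by positivity)]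
        calc |3 * W ω ^ 2 - 8 * t ω| ≤ 3 * (2 * δ) ^ 2 + 8 * (2 * δ ^ 2) := g3
          _ = (3 * (2 * δ) ^ 2 + 8 * (2 * δ ^ 2)) * 1 := (mul_one _).symm
          _ ≤ (3 * (2 * δ) ^ 2 + 8 * (2 * δ ^ 2)) * |x| ^ 2 :=
              mul_le_mul_of_nonneg_left hx1 (by positivity)
      calc |2 * W ω / x + (3 * W ω ^ 2 - 8 * t ω) / x ^ 2|
          ≤ |2 * W ω / x| + |(3 * W ω ^ 2 - 8 * t ω) / x ^ 2| := abs_add_le _ _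
        _ ≤ 2 * (2 * δ) + (3 * (2 * δ) ^ 2 + 8 * (2 * δ ^ 2)) := add_le_add g1 g2
        _ = 4 * δ + 28 * δ ^ 2 := by ring
    -- integrability of `q` (it is within `O(δ³)` of a bounded quantity)
    have hqi : Integrable q P := by
      refine Integrable.of_bound hqm (K * δ ^ 3 + C * δ ^ 3 + 1 + (4 * δ + 28 * δ ^ 2))
        (ae_of_all _ fun ω ↦ ?_)
      rw [Real.norm_eq_abs]
      have d : q ω = (q ω - touchF x (U ω) (D ω) (W ω)) +
          (touchF x (U ω) (D ω) (W ω) - 1 - (2 * W ω / x + (3 * W ω ^ 2 - 8 * t ω) / x ^ 2)) +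
          1 + (2 * W ω / x + (3 * W ω ^ 2 - 8 * t ω) / x ^ 2) := by ring
      rw [d]
      exact (abs_add_le _ _).trans (add_le_add ((abs_add_le _ _).trans (add_le_add
        ((abs_add_le _ _).trans (add_le_add (hq ω) (e ω))) abs_one.le)) (lin ω))
    -- integrate the pointwise expansion against `E[q] = 1`
    have i1 : Integrable (fun ω ↦ 2 * W ω / x) P := (hWi.const_mul 2).div_const x
    have hW3 : Integrable (fun ω ↦ 3 * W ω ^ 2) P := hW2i.const_mul 3
    have ht8 : Integrable (fun ω ↦ 8 * t ω) P := hti.const_mul 8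
    have i2 : Integrable (fun ω ↦ 3 * W ω ^ 2 - 8 * t ω) P := hW3.sub ht8
    have i3 : Integrable (fun ω ↦ (3 * W ω ^ 2 - 8 * t ω) / x ^ 2) P := i2.div_const (x ^ 2)
    have hXi : Integrable (fun ω ↦ 2 * W ω / x + (3 * W ω ^ 2 - 8 * t ω) / x ^ 2) P := i1.add i3
    have hX : |∫ ω, (2 * W ω / x + (3 * W ω ^ 2 - 8 * t ω) / x ^ 2) ∂P| ≤
        |(1 : ℝ)| * ((C + K) * δ ^ 3) := by
      refine USTPeano.KeyEstimate.abs_integral_le_of_pointwise one_ne_zero hXi hqi hqint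
        fun ω ↦ ?_
      have : (2 * W ω / x + (3 * W ω ^ 2 - 8 * t ω) / x ^ 2) / 1 - (q ω - 1) =
          -(touchF x (U ω) (D ω) (W ω) - 1 -
              (2 * W ω / x + (3 * W ω ^ 2 - 8 * t ω) / x ^ 2)) -
            (q ω - touchF x (U ω) (D ω) (W ω)) := by ring
      rw [this]
      refine (abs_sub _ _).trans ?_
      rw [abs_neg]
      linarith [e ω, hq ω]
    have hXeq : ∫ ω, (2 * W ω / x + (3 * W ω ^ 2 - 8 * t ω) / x ^ 2) ∂P =
        2 * (∫ ω, W ω ∂P) / x + (3 * (∫ ω, W ω ^ 2 ∂P) - 8 * (∫ ω, t ω ∂P)) / x ^ 2 := by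
      rw [integral_add i1 i3, integral_div, integral_div, integral_const_mul, integral_sub hW3 ht8,
        integral_const_mul, integral_const_mul]
    rw [hXeq, abs_one, one_mul] at hX
    exact hX
  have r₁ := relation x₁ U₁ D₁ q₁ (by rw [hax₁]; exact hx₁) (by rw [hax₁]; exact hx₁') hq₁m hU₁ hD₁
    hq₁ hq₁int
  have r₂ := relation x₂ U₂ D₂ q₂ (by rw [hax₂]; linarith) (by rw [hax₂]; linarith) hq₂m hU₂ hD₂
    hq₂ hq₂int
  obtain ⟨hB, hM⟩ := touch_key_relations hx₁ hx₁' hx₂ hx₂' r₁ r₂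
  have hε0 : 0 ≤ (C + K) * δ ^ 3 := (abs_nonneg _).trans r₁
  refine ⟨hB.trans (by linarith), ?_⟩
  have e : ∫ ω, W ω ^ 2 ∂P - 8 / 3 * ∫ ω, t ω ∂P =
      (3 * (∫ ω, W ω ^ 2 ∂P) - 8 * (∫ ω, t ω ∂P)) / 3 := by ring
  rw [e, abs_div, abs_of_pos (by norm_num : (0 : ℝ) < 3), div_le_iff₀ (by norm_num : (0 : ℝ) < 3)]
  linarith

end Literature.Probability.RandomPlanarGeometry.SAWDriving

end
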